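import Summits.AtomisticToContinuum.HydrodynamicLimit.Theses.ImplosionDichotomy
import Summits.AtomisticToContinuum.HydrodynamicLimit.Theorems.ImplosionDichotomyPolynomialCompressionUniqueness
import Summits.AtomisticToContinuum.HydrodynamicLimit.Theorems.ImplosionDichotomyHsEosLowDensity
import Summits.AtomisticToContinuum.HydrodynamicLimit.Theorems.ImplosionDichotomyPolynomialCompressionStaticsLLN
import Summits.AtomisticToContinuum.HydrodynamicLimit.Theorems.ImplosionDichotomyPolynomialCompressionStaticsSmoothRate
import Summits.AtomisticToContinuum.HydrodynamicLimit.Theorems.PolynomialCompression.Negative.PdeForm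

/-!
# `ImplosionDichotomy.EosContinuity` reduced to near-ideal stability of the hard-sphere Euler family

Support item stmt-AtomisticToContinuum-12589 (`EosContinuity`, route `ImplosionDichotomy`): continuous
dependence on the equation-of-state parameter `σ` at `σ = 0`, WITH existence — given profiles and a classical
ideal-gas (`σ = 0`) solution `(ρ₁, u₁, θ₁)` on `[0, T₁)` with data `(a₀/∫a₀, u₀, θ₀)`, for `0 < T₂ < T₁` and
`ε > 0` there is `σ₀` such that for `0 < σ < σ₀` (i) an ADMISSIBLE classical hard-sphere Euler solution (its
`t = 0` fields are the law-of-large-numbers limit of the local Gibbs laws, through every flow family) exists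
beyond `T₂`, and (ii) every admissible classical solution is `ε`-close to `ρ₁` in sup norm up to `min(T, T₂)`.

This file removes the particles, the statistics and the uniqueness from the item. Using the tree's
* `hsEosLowDensity_proof` (the hard-sphere free energy is analytic at small packing) and
  `hsEuler_unique_of_analytic_eos` (relative-energy uniqueness of classical solutions at small packing), glued
  here into the unconditional `hsEuler_unique_smallPacking` and its one-sided form
  `hsEuler_unique_of_packing_le_half` (packing hypothesis on ONE of the two solutions only: open–closed
  argument in time with the tube lemma over `𝕋³`);
* `stub_staticsLLN` / `stub_staticsSmoothRate` (identified LLN of the local Gibbs laws towards the explicit,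
  smooth density `rhoLim (profileOf a₀) σ`, `Cⁿ`-close to `a₀/∫a₀` at rate `σ³`) and
  `PolynomialCompressionPDE.admissible_iff_data` (admissibility PINS the data to `(rhoLim, u₀, θ₀)`),
we prove `eosContinuity_of_nearIdealStability`: `EosContinuity` follows from ONE deterministic PDE statement,
the **near-ideal stability of the hard-sphere Euler family** — for a classical ideal-gas solution on `[0, T₁)`,
`T₂ < T₁` and `ε > 0` there are `k` and `δ > 0` such that for every `0 < σ < δ` and every smooth positive density
datum `δ`-close to `ρ₁(0)` in `Cᵏ`, a classical `σ`-solution with data `(ρ₀, u₁(0), θ₁(0))` exists beyond `T₂`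
and stays `ε`-close to `ρ₁` — i.e. Kato's continuous dependence on the data and on the (analytic) nonlinearity
for the symmetrisable-hyperbolic 5×5 system (Kato 1975 Thms II–III; Majda 1984 Thms 2.1–2.2), which is the
part of the item not in the tree.
-/

noncomputable section

namespace Summit.AtomisticToContinuum.HydrodynamicLimit.Theorems

open Set Filter Topology MeasureTheory
open scoped ContDiff
open Literature.MathematicalPhysics.KineticTheory Literature.Analysis.FunctionSpaces
open Summit.AtomisticToContinuum.HydrodynamicLimit.Theses.ImplosionDichotomy (EosContinuity)

/-! ### Uniqueness of classical hard-sphere Euler solutions at small packing (unconditional) -/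

/-- **Uniqueness at small packing, unconditionally.** There is a packing threshold `η₁ > 0` such that
for every reduced diameter `σ > 0` two classical hard-sphere Euler solutions on `[0, T) × 𝕋³` with packing
`ρσ³, ρ'σ³ ≤ η₁` and equal data coincide on `[0, T)`: `hsEuler_unique_of_analytic_eos` with the equation
of state supplied by `hsEosLowDensity_proof`. [folklore] -/
theorem hsEuler_unique_smallPacking :
    ∃ η₁ : ℝ, 0 < η₁ ∧ ∀ σ : ℝ, 0 < σ →
      ∀ (T : ℝ) (ρ θ : ℝ → T3 → ℝ) (u : ℝ → T3 → V3) (ρ' θ' : ℝ → T3 → ℝ) (u' : ℝ → T3 → V3),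
        IsHardSphereEulerSolution σ T ρ u θ → IsHardSphereEulerSolution σ T ρ' u' θ' →
        (∀ t ∈ Ico 0 T, ∀ x, ρ t x * σ ^ 3 ≤ η₁) → (∀ t ∈ Ico 0 T, ∀ x, ρ' t x * σ ^ 3 ≤ η₁) →
        ρ 0 = ρ' 0 → u 0 = u' 0 → θ 0 = θ' 0 →
        ∀ t ∈ Ico 0 T, ρ t = ρ' t ∧ u t = u' t ∧ θ t = θ' t := by
  obtain ⟨η₀, hη₀, F, hF, hEq, -, -, -⟩ := hsEosLowDensity_proof
  exact hsEuler_unique_of_analytic_eos η₀ hη₀ F hF hEq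

/-- **One-sided small-packing uniqueness.** Given the two-sided uniqueness statement at packing `≤ η₁`
(as provided by `hsEuler_unique_smallPacking` at a fixed `σ > 0`): if two classical hard-sphere Euler solutions
on `[0, T)` have the same data and ONE of them has packing `≤ η₁/2` throughout, they coincide on `[0, T)` —
no packing hypothesis on the other. Open–closed argument: up to the first time `tᵢ` at which the packing of
the second solution exceeds `η₁` the solutions agree, so its packing at `tᵢ` is `≤ η₁/2`, and by uniform-in-space
continuity in time (tube lemma over the compact torus) it stays `< η₁` shortly after `tᵢ` — contradiction.
[folklore] -/
theorem hsEuler_unique_of_packing_le_half {η₁ σ T : ℝ}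
    (huniq : ∀ (T : ℝ) (ρ θ : ℝ → T3 → ℝ) (u : ℝ → T3 → V3) (ρ' θ' : ℝ → T3 → ℝ) (u' : ℝ → T3 → V3),
        IsHardSphereEulerSolution σ T ρ u θ → IsHardSphereEulerSolution σ T ρ' u' θ' →
        (∀ t ∈ Ico 0 T, ∀ x, ρ t x * σ ^ 3 ≤ η₁) → (∀ t ∈ Ico 0 T, ∀ x, ρ' t x * σ ^ 3 ≤ η₁) →
        ρ 0 = ρ' 0 → u 0 = u' 0 → θ 0 = θ' 0 →
        ∀ t ∈ Ico 0 T, ρ t = ρ' t ∧ u t = u' t ∧ θ t = θ' t)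
    (hη₁ : 0 < η₁) (hσ : 0 < σ)
    {ρ θ ρ' θ' : ℝ → T3 → ℝ} {u u' : ℝ → T3 → V3}
    (hE : IsHardSphereEulerSolution σ T ρ u θ) (hE' : IsHardSphereEulerSolution σ T ρ' u' θ')
    (hpk' : ∀ t ∈ Ico 0 T, ∀ x, ρ' t x * σ ^ 3 ≤ η₁ / 2)
    (h0 : ρ 0 = ρ' 0) (hu0 : u 0 = u' 0) (hθ0 : θ 0 = θ' 0) :
    ∀ t ∈ Ico 0 T, ρ t = ρ' t ∧ u t = u' t ∧ θ t = θ' t := by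
  -- uniqueness on every horizon `s ≤ T` before which the packing of `ρ` is `≤ η₁`
  have hA : ∀ s ≤ T, (∀ t ∈ Ico 0 s, ∀ x, ρ t x * σ ^ 3 ≤ η₁) →
      ∀ t ∈ Ico 0 s, ρ t = ρ' t ∧ u t = u' t ∧ θ t = θ' t := fun s hs hgood =>
    huniq s ρ θ u ρ' θ' u' (isHardSphereEulerSolution_restrict hE hs)
      (isHardSphereEulerSolution_restrict hE' hs) hgood
      (fun t ht x => (hpk' t ⟨ht.1, ht.2.trans_le hs⟩ x).trans (by linarith)) h0 hu0 hθ0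
  suffices hgood : ∀ t ∈ Ico 0 T, ∀ x, ρ t x * σ ^ 3 ≤ η₁ from hA T le_rfl hgood
  by_contra hbad
  push Not at hbad
  obtain ⟨t₀, ht₀, x₀, hx₀⟩ := hbad
  -- the bad times and their infimum
  set A : Set ℝ := {t | t ∈ Ico 0 T ∧ ∃ x, η₁ < ρ t x * σ ^ 3} with hAdef
  have ht₀A : t₀ ∈ A := ⟨ht₀, x₀, hx₀⟩
  have hAne : A.Nonempty := ⟨t₀, ht₀A⟩
  have hAbdd : BddBelow A := ⟨0, fun t ht => ht.1.1⟩
  set ti : ℝ := sInf A with hti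
  have hti_le : ti ≤ t₀ := csInf_le hAbdd ht₀A
  have hti_ge : 0 ≤ ti := le_csInf hAne fun t ht => ht.1.1
  have hti_mem : ti ∈ Ico 0 T := ⟨hti_ge, hti_le.trans_lt ht₀.2⟩
  -- before `ti` the packing of `ρ` is `≤ η₁`, so the two solutions agree on `[0, ti)`
  have hgood_ti : ∀ t ∈ Ico 0 ti, ∀ x, ρ t x * σ ^ 3 ≤ η₁ := by
    intro t ht x
    by_contra hlt
    push Not at hlt
    have htA : t ∈ A := ⟨⟨ht.1, ht.2.trans hti_mem.2⟩, x, hlt⟩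
    exact absurd (csInf_le hAbdd htA) (not_le.2 ht.2)
  have hagree : ∀ t ∈ Ico 0 ti, ρ t = ρ' t ∧ u t = u' t ∧ θ t = θ' t :=
    hA ti hti_mem.2.le hgood_ti
  -- the densities agree at `ti` as well (data if `ti = 0`, continuity from the left otherwise)
  have hti_eq : ρ ti = ρ' ti := by
    rcases hti_ge.eq_or_lt with h | hpos
    · rw [← h]; exact h0
    · funext x
      refine eq_of_forall_dist_le fun ε hε => ?_
      have h1 := hE.smooth_density.eventually_norm_sub_lt hti_mem (half_pos hε)
      have h2 := hE'.smooth_density.eventually_norm_sub_lt hti_mem (half_pos hε)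
      have hle : 𝓝[Ico 0 ti] ti ≤ 𝓝[Ico 0 T] ti :=
        nhdsWithin_mono _ (Ico_subset_Ico_right hti_mem.2.le)
      have h3 : ∀ᶠ s in 𝓝[Ico 0 ti] ti, ρ s = ρ' s :=
        eventually_nhdsWithin_of_forall fun s hs => (hagree s hs).1
      haveI : (𝓝[Ico 0 ti] ti).NeBot := right_nhdsWithin_Ico_neBot hpos
      obtain ⟨s, hs1, hs2, hs3⟩ := ((h1.filter_mono hle).and ((h2.filter_mono hle).and h3)).exists
      have e1 : ‖ρ s x - ρ ti x‖ < ε / 2 := hs1 x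
      have e2 : ‖ρ' s x - ρ' ti x‖ < ε / 2 := hs2 x
      have e3 : ρ s x = ρ' s x := congrFun hs3 x
      rw [dist_eq_norm]
      calc ‖ρ ti x - ρ' ti x‖ = ‖(ρ' s x - ρ' ti x) - (ρ s x - ρ ti x)‖ := by
            rw [e3]; congr 1; ring
        _ ≤ ‖ρ' s x - ρ' ti x‖ + ‖ρ s x - ρ ti x‖ := norm_sub_le _ _
        _ ≤ ε := by linarith
  -- hence the packing of `ρ` at `ti` is at most `η₁ / 2` …
  have hpk_ti : ∀ x, ρ ti x * σ ^ 3 ≤ η₁ / 2 := fun x => by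
    rw [hti_eq]; exact hpk' ti hti_mem x
  -- … and `< η₁` shortly after `ti` (tube lemma), so no bad time is close to `ti`
  have hσ3 : 0 < σ ^ 3 := pow_pos hσ 3
  have hev : ∀ᶠ s in 𝓝[Ico 0 T] ti, ∀ x, ‖ρ s x - ρ ti x‖ < η₁ / 2 / σ ^ 3 :=
    hE.smooth_density.eventually_norm_sub_lt hti_mem (by positivity)
  have hev' : ∀ᶠ s in 𝓝[Ico 0 T] ti, s ∉ A := by
    filter_upwards [hev] with s hs
    rintro ⟨-, x, hx⟩
    have h1 : ρ s x - ρ ti x < η₁ / 2 / σ ^ 3 :=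
      lt_of_le_of_lt (le_abs_self _) (by simpa only [Real.norm_eq_abs] using hs x)
    have h2 : ρ ti x ≤ η₁ / 2 / σ ^ 3 := by rw [le_div_iff₀ hσ3]; exact hpk_ti x
    have h3 : ρ s x < η₁ / σ ^ 3 := by
      have : η₁ / 2 / σ ^ 3 + η₁ / 2 / σ ^ 3 = η₁ / σ ^ 3 := by ring
      linarith
    have h4 : ρ s x * σ ^ 3 < η₁ := (lt_div_iff₀ hσ3).1 h3
    exact absurd hx (not_lt.2 h4.le)
  obtain ⟨r, hr, hball⟩ : ∃ r > 0, ∀ s ∈ Ico 0 T, dist s ti < r → s ∉ A := by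
    rw [eventually_nhdsWithin_iff, Metric.eventually_nhds_iff] at hev'
    obtain ⟨r, hr, h⟩ := hev'
    exact ⟨r, hr, fun s hs hd => h hd hs⟩
  -- but `ti = inf A`: some bad time lies within `r` of `ti`
  have hlt : sInf A < ti + r := by rw [← hti]; linarith
  obtain ⟨a, haA, har⟩ := exists_lt_of_csInf_lt hAne hlt
  have hati : ti ≤ a := csInf_le hAbdd haA
  have hdist : dist a ti < r := by
    rw [Real.dist_eq, abs_of_nonneg (by linarith)]; linarith
  exact hball a haA.1 hdist haA

/-! ### The reduction -/

/-- **`EosContinuity` from near-ideal stability of the hard-sphere Euler family.** HYPOTHESIS `hA`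
(the deterministic PDE input; Kato 1975 Thms II–III / Majda 1984 Thms 2.1–2.2 for the symmetrisable
hyperbolic 5×5 hard-sphere Euler system at small packing, where the typed equation of state is analytic by
`hsEosLowDensity_proof`): for every classical ideal-gas (`σ = 0`) solution `(ρ₁, u₁, θ₁)` on `[0, T₁)`, every
`0 < T₂ < T₁` and `ε > 0` there are an order `k` and `δ > 0` such that for all `0 < σ < δ` and every smooth
positive density datum `ρ₀` with `‖Dⁿ lift(ρ₀ − ρ₁(0))‖ ≤ δ` on `ℝ³` for `n ≤ k`, a classical hard-sphere Euler
solution at reduced diameter `σ` with data `(ρ₀, u₁(0), θ₁(0))` exists on some `[0, T)`, `T > T₂`, with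
`|ρ − ρ₁| < ε` on `[0, T) × 𝕋³`. CONCLUSION: the route item `EosContinuity`. Proof: the admissible data at
`σ` are pinned to `(rhoLim (profileOf a₀) σ, u₀, θ₀)` (`admissible_iff_data`), `rhoLim` is smooth, positive and
`Cⁿ`-close to `a₀/∫a₀ = ρ₁(0)` at rate `σ³` (`stub_staticsLLN`, `stub_staticsSmoothRate`; `a₀` is smooth because
`ρ₁(0)` is), so `hA` produces the admissible solution of clause (i); any admissible solution has the same data,
hence (one-sided small-packing uniqueness, the reference having packing `≤ (sup ρ₁ + ε)σ³ ≤ η₁/2` up to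
`(T₂+T₁)/2`) coincides with it up to `min(T, T₂)`, which gives clause (ii). [folklore] -/
theorem eosContinuity_of_nearIdealStability
    (hA : ∀ (T₁ : ℝ) (ρ₁ θ₁ : ℝ → T3 → ℝ) (u₁ : ℝ → T3 → V3),
      IsHardSphereEulerSolution 0 T₁ ρ₁ u₁ θ₁ → ∀ T₂ : ℝ, 0 < T₂ → T₂ < T₁ → ∀ ε : ℝ, 0 < ε →
      ∃ k : ℕ, ∃ δ : ℝ, 0 < δ ∧ ∀ σ : ℝ, 0 < σ → σ < δ →
        ∀ ρ₀ : T3 → ℝ, Torus.IsSmooth ρ₀ → (∀ x, 0 < ρ₀ x) →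
          (∀ n : ℕ, n ≤ k → ∀ y : EuclideanSpace ℝ (Fin 3),
            ‖iteratedFDeriv ℝ n (Torus.lift fun x => ρ₀ x - ρ₁ 0 x) y‖ ≤ δ) →
          ∃ T : ℝ, T₂ < T ∧ ∃ (ρ θ : ℝ → T3 → ℝ) (u : ℝ → T3 → V3),
            IsHardSphereEulerSolution σ T ρ u θ ∧ ρ 0 = ρ₀ ∧ u 0 = u₁ 0 ∧ θ 0 = θ₁ 0 ∧
            ∀ t ∈ Ico 0 T, ∀ x, |ρ t x - ρ₁ t x| < ε) :
    EosContinuity := by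
  obtain ⟨η₁, hη₁, huniq⟩ := hsEuler_unique_smallPacking
  intro a₀ θ₀ u₀ ha hθ hu ha0 hθ0 T₁ ρ₁ θ₁ u₁ hE₁ hρ₁0 hu₁0 hθ₁0 T₂ hT₂ hT₂₁ ε hε
  have hT₁ : 0 < T₁ := hT₂.trans hT₂₁
  have h0T₁ : (0 : ℝ) ∈ Ico 0 T₁ := ⟨le_rfl, hT₁⟩
  -- `a₀` is smooth, being a constant multiple of the smooth slice `ρ₁ 0`
  have hI : 0 < ∫ y, a₀ y := integral_pos_of_continuous_pos ha ha0
  have hρ₁s : Torus.IsSmooth (ρ₁ 0) := hE₁.smooth_density.isSmooth_slice h0T₁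
  have has : Torus.IsSmooth a₀ := by
    have h : a₀ = fun x => ρ₁ 0 x * ∫ y, a₀ y := by
      funext x; rw [hρ₁0 x, div_mul_cancel₀ _ hI.ne']
    rw [h]
    show ContDiff ℝ ∞ fun y => Torus.lift (ρ₁ 0) y * ∫ y, a₀ y
    exact hρ₁s.mul contDiff_const
  -- statics: identified LLN, smooth `σ³`-rate, data pinning
  obtain ⟨σ₁, hσ₁, Hst⟩ := stub_staticsLLN a₀ θ₀ u₀ ha hθ hu ha0 hθ0
  obtain ⟨hsm, hrate⟩ := stub_staticsSmoothRate a₀ has ha0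
  obtain ⟨σ₂, hσ₂, -, Hadm⟩ := PolynomialCompressionPDE.admissible_iff_data (u₀ := u₀) ha hθ hu ha0 hθ0
  -- the PDE input for this reference solution
  obtain ⟨k, δ, hδ, HA⟩ := hA T₁ ρ₁ θ₁ u₁ hE₁ T₂ hT₂ hT₂₁ ε hε
  -- rate constants up to order `k`
  choose C hC using hrate
  set Cmax : ℝ := ∑ n ∈ Finset.range (k + 1), |C n| with hCmax
  have hCmax0 : 0 ≤ Cmax := Finset.sum_nonneg fun n _ => abs_nonneg _
  have hCle : ∀ n ≤ k, C n ≤ Cmax := fun n hn =>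
    (le_abs_self _).trans (Finset.single_le_sum (f := fun n => |C n|) (fun m _ => abs_nonneg _)
      (Finset.mem_range.2 (Nat.lt_succ_of_le hn)))
  -- a bound of `ρ₁` on `[0, T₂'] × 𝕋³`, `T₂ < T₂' < T₁`
  set T₂' : ℝ := (T₂ + T₁) / 2 with hT₂'
  have hT₂'lt : T₂' < T₁ := by rw [hT₂']; linarith
  have hT₂lt' : T₂ < T₂' := by rw [hT₂']; linarith
  obtain ⟨B, hB0, hB⟩ := exists_abs_le_of_isSmoothSpaceTimeOn hE₁.smooth_density hT₂'lt
  have hBε : 0 < B + ε := by linarith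
  -- the threshold
  refine ⟨min (min (min σ₁ σ₂) (min δ 1)) (min (η₁ / (2 * (B + ε))) (δ / (Cmax + 1))),
    lt_min (lt_min (lt_min hσ₁ hσ₂) (lt_min hδ zero_lt_one)) (lt_min (by positivity) (by positivity)),
    fun σ hσ hσlt => ?_⟩
  have hσσ₁ : σ < σ₁ :=
    hσlt.trans_le (((min_le_left _ _).trans (min_le_left _ _)).trans (min_le_left _ _))
  have hσσ₂ : σ < σ₂ :=
    hσlt.trans_le (((min_le_left _ _).trans (min_le_left _ _)).trans (min_le_right _ _))
  have hσδ : σ < δ :=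
    hσlt.trans_le (((min_le_left _ _).trans (min_le_right _ _)).trans (min_le_left _ _))
  have hσ1 : σ < 1 :=
    hσlt.trans_le (((min_le_left _ _).trans (min_le_right _ _)).trans (min_le_right _ _))
  have hση : σ < η₁ / (2 * (B + ε)) := hσlt.trans_le ((min_le_right _ _).trans (min_le_left _ _))
  have hσC : σ < δ / (Cmax + 1) := hσlt.trans_le ((min_le_right _ _).trans (min_le_right _ _))
  have hσ3 : 0 < σ ^ 3 := pow_pos hσ 3
  have hσ3le : σ ^ 3 ≤ σ := pow_le_of_le_one hσ.le hσ1.le (by norm_num)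
  obtain ⟨hSD, hpos, -⟩ := Hst σ hσ hσσ₁
  obtain ⟨-, Hadmσ⟩ := Hadm σ hσ hσσ₂
  -- the pinned, smooth, `σ³`-close datum `ρ₀ = rhoLim (profileOf a₀) σ`
  have hρ₀s : Torus.IsSmooth (rhoLim (profileOf a₀ ha ha0) σ) := hsm σ hSD
  have hdata : ∀ n : ℕ, n ≤ k → ∀ y : EuclideanSpace ℝ (Fin 3),
      ‖iteratedFDeriv ℝ n (Torus.lift fun x => rhoLim (profileOf a₀ ha ha0) σ x - ρ₁ 0 x) y‖ ≤ δ := by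
    intro n hn y
    have h1 : ‖iteratedFDeriv ℝ n
        (Torus.lift fun x => rhoLim (profileOf a₀ ha ha0) σ x - a₀ x / ∫ z, a₀ z) y‖ ≤ C n * σ ^ 3 :=
      hC n σ hSD y
    have h2 : (Torus.lift fun x => rhoLim (profileOf a₀ ha ha0) σ x - ρ₁ 0 x) =
        Torus.lift fun x => rhoLim (profileOf a₀ ha ha0) σ x - a₀ x / ∫ z, a₀ z := by
      simp only [hρ₁0]
    rw [h2]
    have h3 : C n * σ ^ 3 ≤ Cmax * σ := by
      calc C n * σ ^ 3 ≤ Cmax * σ ^ 3 := mul_le_mul_of_nonneg_right (hCle n hn) hσ3.le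
        _ ≤ Cmax * σ := mul_le_mul_of_nonneg_left hσ3le hCmax0
    have h4 : Cmax * σ ≤ δ := by
      have h5 : σ * (Cmax + 1) < δ := (lt_div_iff₀ (by positivity)).1 hσC
      nlinarith
    exact h1.trans (h3.trans h4)
  obtain ⟨T, hT₂T, ρs, θs, us, hEs, hρs0, hus0, hθs0, hclose⟩ :=
    HA σ hσ hσδ (rhoLim (profileOf a₀ ha ha0) σ) hρ₀s hpos hdata
  have hT0 : 0 < T := hT₂.trans hT₂T
  refine ⟨⟨T, ρs, θs, us, hT₂T, hEs, ?_⟩, ?_⟩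
  · -- clause (i): the reference solution is admissible (its data are the pinned data)
    obtain ⟨hc1, hc2, hc3⟩ := PolynomialCompressionPDE.continuous_slices_zero hEs hT0
    exact (Hadmσ ρs θs us hc1 hc2 hc3).2 ⟨hρs0, hus0.trans hu₁0, hθs0.trans hθ₁0⟩
  · -- clause (ii): every admissible solution coincides with the reference up to `min (T, T₂)`
    intro T' ρ θ u hE hadm t ht htT₂ x
    have hT'0 : 0 < T' := ht.1.trans_lt ht.2
    obtain ⟨hc1, hc2, hc3⟩ := PolynomialCompressionPDE.continuous_slices_zero hE hT'0
    obtain ⟨hρ0, hu0, hθ0'⟩ := (Hadmσ ρ θ u hc1 hc2 hc3).1 hadm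
    -- common horizon `Tc = min (T', T, T₂')`
    have htTc : t < min T' (min T T₂') :=
      lt_min ht.2 (lt_min (htT₂.trans_lt hT₂T) (htT₂.trans_lt hT₂lt'))
    have hEc : IsHardSphereEulerSolution σ (min T' (min T T₂')) ρ u θ :=
      isHardSphereEulerSolution_restrict hE (min_le_left _ _)
    have hEsc : IsHardSphereEulerSolution σ (min T' (min T T₂')) ρs us θs :=
      isHardSphereEulerSolution_restrict hEs ((min_le_right _ _).trans (min_le_left _ _))
    -- the reference solution has packing `≤ η₁ / 2` there
    have hpk : ∀ s ∈ Ico 0 (min T' (min T T₂')), ∀ y, ρs s y * σ ^ 3 ≤ η₁ / 2 := by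
      intro s hs y
      have hsT : s ∈ Ico 0 T := ⟨hs.1, hs.2.trans_le ((min_le_right _ _).trans (min_le_left _ _))⟩
      have hsT₂' : s ∈ Icc 0 T₂' :=
        ⟨hs.1, (hs.2.trans_le ((min_le_right _ _).trans (min_le_right _ _))).le⟩
      have h1 : |ρs s y - ρ₁ s y| < ε := hclose s hsT y
      have h2 : |ρ₁ s y| ≤ B := hB s hsT₂' y
      have h3 : ρs s y ≤ B + ε := by linarith [(abs_lt.1 h1).2, le_abs_self (ρ₁ s y)]
      have h4 : σ ^ 3 ≤ η₁ / (2 * (B + ε)) := hσ3le.trans hση.le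
      calc ρs s y * σ ^ 3 ≤ (B + ε) * (η₁ / (2 * (B + ε))) := mul_le_mul h3 h4 hσ3.le hBε.le
        _ = η₁ / 2 := by field_simp
    have hagree := hsEuler_unique_of_packing_le_half (huniq σ hσ) hη₁ hσ hEc hEsc hpk
      (hρ0.trans hρs0.symm) (hu0.trans (hus0.trans hu₁0).symm) (hθ0'.trans (hθs0.trans hθ₁0).symm)
      t ⟨ht.1, htTc⟩
    rw [congrFun hagree.1 x]
    exact hclose t ⟨ht.1, htT₂.trans_lt hT₂T⟩ x

/-! ### `EosContinuity` is a particle-free PDE statement -/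

/-- **`EosContinuity`, de-probabilised.** No flows, no measures, no law of large numbers: the route item is
EQUIVALENT to the deterministic statement obtained by replacing "admissible" (tied at `t = 0` to the local Gibbs
laws through every flow family) by the PINNED DATA `ρ 0 = rhoLim (profileOf a₀) σ ∧ u 0 = u₀ ∧ θ 0 = θ₀`
(`PolynomialCompressionPDE.admissible_iff_data`; both directions shrink `σ₀` below the statics threshold
`σ₁(a₀, θ₀, u₀)`, and the horizons involved are positive so the time-`0` slices are continuous). [folklore] -/
theorem eosContinuity_iff_pde :
    EosContinuity ↔
      ∀ (a₀ θ₀ : T3 → ℝ) (u₀ : T3 → V3) (ha : Continuous a₀) (ha0 : ∀ x, 0 < a₀ x),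
        Continuous θ₀ → Continuous u₀ → (∀ x, 0 < θ₀ x) →
        ∀ (T₁ : ℝ) (ρ₁ θ₁ : ℝ → T3 → ℝ) (u₁ : ℝ → T3 → V3),
          IsHardSphereEulerSolution 0 T₁ ρ₁ u₁ θ₁ → (∀ x, ρ₁ 0 x = a₀ x / ∫ y, a₀ y) → u₁ 0 = u₀ →
          θ₁ 0 = θ₀ → ∀ T₂ : ℝ, 0 < T₂ → T₂ < T₁ → ∀ ε : ℝ, 0 < ε →
          ∃ σ₀ : ℝ, 0 < σ₀ ∧ ∀ σ : ℝ, 0 < σ → σ < σ₀ →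
            (∃ (T : ℝ) (ρ θ : ℝ → T3 → ℝ) (u : ℝ → T3 → V3), T₂ < T ∧
              IsHardSphereEulerSolution σ T ρ u θ ∧
              ρ 0 = rhoLim (profileOf a₀ ha ha0) σ ∧ u 0 = u₀ ∧ θ 0 = θ₀) ∧
            ∀ (T : ℝ) (ρ θ : ℝ → T3 → ℝ) (u : ℝ → T3 → V3), IsHardSphereEulerSolution σ T ρ u θ →
              ρ 0 = rhoLim (profileOf a₀ ha ha0) σ → u 0 = u₀ → θ 0 = θ₀ →
              ∀ t ∈ Ico 0 T, t ≤ T₂ → ∀ x, |ρ t x - ρ₁ t x| < ε := by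
  constructor
  · intro H a₀ θ₀ u₀ ha ha0 hθ hu hθ0 T₁ ρ₁ θ₁ u₁ hE₁ hρ₁0 hu₁0 hθ₁0 T₂ hT₂ hT₂₁ ε hε
    obtain ⟨σ₁, hσ₁, -, G⟩ := PolynomialCompressionPDE.admissible_iff_data (u₀ := u₀) ha hθ hu ha0 hθ0
    obtain ⟨σ₀, hσ₀, Hσ⟩ := H a₀ θ₀ u₀ ha hθ hu ha0 hθ0 T₁ ρ₁ θ₁ u₁ hE₁ hρ₁0 hu₁0 hθ₁0 T₂ hT₂ hT₂₁ ε hε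
    refine ⟨min σ₀ σ₁, lt_min hσ₀ hσ₁, fun σ hσ hσlt => ?_⟩
    obtain ⟨⟨T, ρ, θ, u, hT, hE, hadm⟩, Huniq⟩ := Hσ σ hσ (hσlt.trans_le (min_le_left _ _))
    obtain ⟨-, G'⟩ := G σ hσ (hσlt.trans_le (min_le_right _ _))
    refine ⟨⟨T, ρ, θ, u, hT, hE, ?_⟩, fun T' ρ' θ' u' hE' h1 h2 h3 t ht htT₂ x => ?_⟩
    · obtain ⟨hc1, hc2, hc3⟩ := PolynomialCompressionPDE.continuous_slices_zero hE (hT₂.trans hT)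
      exact (G' ρ θ u hc1 hc2 hc3).1 hadm
    · obtain ⟨hc1, hc2, hc3⟩ := PolynomialCompressionPDE.continuous_slices_zero hE' (ht.1.trans_lt ht.2)
      exact Huniq T' ρ' θ' u' hE' ((G' ρ' θ' u' hc1 hc2 hc3).2 ⟨h1, h2, h3⟩) t ht htT₂ x
  · intro H a₀ θ₀ u₀ ha hθ hu ha0 hθ0 T₁ ρ₁ θ₁ u₁ hE₁ hρ₁0 hu₁0 hθ₁0 T₂ hT₂ hT₂₁ ε hε
    obtain ⟨σ₁, hσ₁, -, G⟩ := PolynomialCompressionPDE.admissible_iff_data (u₀ := u₀) ha hθ hu ha0 hθ0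
    obtain ⟨σ₀, hσ₀, Hσ⟩ := H a₀ θ₀ u₀ ha ha0 hθ hu hθ0 T₁ ρ₁ θ₁ u₁ hE₁ hρ₁0 hu₁0 hθ₁0 T₂ hT₂ hT₂₁ ε hε
    refine ⟨min σ₀ σ₁, lt_min hσ₀ hσ₁, fun σ hσ hσlt => ?_⟩
    obtain ⟨⟨T, ρ, θ, u, hT, hE, h1, h2, h3⟩, Huniq⟩ := Hσ σ hσ (hσlt.trans_le (min_le_left _ _))
    obtain ⟨-, G'⟩ := G σ hσ (hσlt.trans_le (min_le_right _ _))
    refine ⟨⟨T, ρ, θ, u, hT, hE, ?_⟩, fun T' ρ' θ' u' hE' hadm t ht htT₂ x => ?_⟩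
    · obtain ⟨hc1, hc2, hc3⟩ := PolynomialCompressionPDE.continuous_slices_zero hE (hT₂.trans hT)
      exact (G' ρ θ u hc1 hc2 hc3).2 ⟨h1, h2, h3⟩
    · obtain ⟨hc1, hc2, hc3⟩ := PolynomialCompressionPDE.continuous_slices_zero hE' (ht.1.trans_lt ht.2)
      obtain ⟨h1', h2', h3'⟩ := (G' ρ' θ' u' hc1 hc2 hc3).1 hadm
      exact Huniq T' ρ' θ' u' hE' h1' h2' h3' t ht htT₂ x

end Summit.AtomisticToContinuum.HydrodynamicLimit.Theorems

end
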